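import Literature.MathematicalPhysics.QuantumFieldTheory.Balaban1983to89.B9Eq3153FrakGkBoundDiagonal
import Literature.MathematicalPhysics.QuantumFieldTheory.Balaban1983to89.B9Eq386GreenLipschitzEnergy
import Literature.MathematicalPhysics.QuantumFieldTheory.Balaban1983to89.B9Ineq369CurvatureOperatorBound
import Literature.MathematicalPhysics.QuantumFieldTheory.Balaban1983to89.B9Eq315QTowerLipschitzL2
import Literature.MathematicalPhysics.QuantumFieldTheory.Balaban1983to89.B9Eq315QTowerFlatNorm
import Literature.MathematicalPhysics.QuantumFieldTheory.Balaban1983to89.B9Eq384RemainderLetters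
import Literature.MathematicalPhysics.QuantumFieldTheory.Balaban1983to89.B5Eq172HodgePositivity

/-!
# `Balaban1983to89.B9Eq353FormDefectTowerDiagonal` — T. Bałaban, *Propagators for lattice gauge theories in a background field*, Commun. Math. Phys. **99**
# (1985) 389–434 [Balaban1985BackgroundPropagators] (3.52)–(3.53) p. 400 *«Δ_{U′U} = Δ_U − V₁(A)»* with (3.82)–(3.86) p. 407 and Thm 3.11 p. 416 AT `k = n+1`
# AVERAGING LEVELS ON PRINT's DIAGONAL `ηL^{n+1} = 1`: **THE ENERGY DATA OF THE PAIR `(Δ^{(k)}_a(U), Δ^{(k)}_a(1))` — THE TWO STRONG COERCIVITIES IN THE FLAT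
# WEIGHT AND THE FIRST-ORDER FORM DEFECT `‖⟨u, (Δ_a(U) − Δ_a(1))v⟩‖ ≤ Θ̄·α·N₁(u)N₁(v)`, `∃ α₀ γ₁ Θ̄` BEFORE EVERY LATTICE ∕ HEIGHT ∕ WEIGHT ∕ VOLUME ∕
# BACKGROUND BINDER, MODULO THE `R`-LETTER `C_R` ALONE** (the owner's `B9Eq3153FrakGkBoundDiagonal` §1 + `B9Eq386GreenLipschitzEnergy` §1∕§3, first-order letters)

statement-level skeleton of published theorems with citation tags; proofs where landed; nothing here is a claim about the Yang–Mills mass gap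

CITATION HEADER (lean-in-tree rule).  Audit cell `pub-balaban`, sub-cell `t4`, BINDER row NE9; filed by the row OWNER lineage `b2b-balaban-t4-ne9-p1`
(gen 86).  Sources READ first-hand in the held text layer [Balaban1985BackgroundPropagators] (`paper:balaban1985-cmp99-background-propagators`, journal page =
PDF page + 388) pp. 399–400 ((3.50)–(3.53)), 404–405 ((3.69)–(3.73)), 407 ((3.82)–(3.86)), 416 (Thm 3.11).  THE PRINT (verbatim): p. 400 (3.51)–(3.53) *«Expanding
the exponential above we get (Δ_{U′U}λ)(x) = (Δ_Uλ)(x) − … Let us denote the first order operator on the right-hand side above by V₁(A) … Δ_{U′U} = Δ_U − V₁(A)»*.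

WHY THIS FILE (the owner's programme «THE 𝔊-STOREY IN THE ENERGY CURRENCY», D-ne9p1-g86-2).  Every energy-norm perturbation argument on the diagonal (the
Green's function `G_k` in `B9Eq386GreenkLipschitzEnergyDiagonal`; next `H_{1,k}`, `𝔊_k`) consumes the same three data: the STRONG coercivity `γ₁` of the
`k`-th-step operator at `U` and at the flat background in the flat weight `N₁(u)² = ‖curl₁u‖² + ‖div₁u‖² + ‖u‖²` (`B9Eq3153FrakGkBoundDiagonal` §1 twice — the
flat background inhabits every window) and the FORM DEFECT of `Δ^{(k)}_a(U) − Δ^{(k)}_a(1)`, which in the form sense is FIRST order (print's `V₁(A)`):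
`Θ̄` closed in `(d, a, L, M_φ, M_φ′, r, C_τ, ρ_w, C_R)` from the curl∕divergence remainders `8√dM_φM_φ′α`, `2√dM_φM_φ′α` (`B9Eq373DerivativeRemainderL2` with
`εR = 2M_φM_φ′αη`, `‖η⁻¹‖η = 1`), the curvature OPERATOR bound `K_cα` (`B9Ineq369CurvatureOperatorBound`), the displayed `R`-letter `C_Rα` (g85 INTENT-4's slot,
inhabited at the point by ne9-leaf-04's `B9Eq325RLipschitzSqrtTowerLinear`), and the averaging letters `C_Qα`, `M_Q = M_φ′M_φ` (ne9-leaf-02's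
`norm_QkW_sub_flat_le_L2_geometric`, ne9-leaf-03's `norm_QkW_one_le_canonical`), assembled by `B9Eq386GreenLipschitzEnergy.norm_inner_laplaceAK_sub_le`.

WHAT IS PROVED (sorry-free; 0 `def`; [folklore] composition BY NAME + threshold arithmetic; nothing of [B9] asserted as printed).
* **`exists_energy_pair_diagonal_closed`** — `∃ α₀ γ₁ Θ̄ > 0` (`γ₁ = γ(d,a)∕4`; `Θ̄ = s_D(2+s_D) + K_c + s_P(2+s_P) + aC_Q(2M_Q + C_Q) + 1`, `s_P = 2√dM_φM_φ′ + C_R`)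
  BEFORE the binders of `B9Thm311LaplaceAkPositiveDiagonal` + `hR : ‖R_k(U)s − R_k(1)s‖ ≤ C_Rα‖s‖`, then (i) `γ₁N₁(x)² ≤ re⟨x, Δ^{(n+1)}_a(U)x⟩`,
  (ii) `γ₁N₁(x)² ≤ re⟨x, Δ^{(n+1)}_a(1)x⟩` (canonical flat tower letters), (iii) `‖⟨u, Δ^{(n+1)}_a(U)v⟩ − ⟨u, Δ^{(n+1)}_a(1)v⟩‖ ≤ Θ̄·α·N₁(u)·N₁(v)`.
HONEST SCOPE.  FIRST order at the flat point on the diagonal ONLY; the small-field WINDOWS, `hRS`, `C_τ`, `ρ_w`, `C_R` stay HYPOTHESES; crude constants; no kernel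
bound, no decay.  NOT summit progress (cell pub-balaban: NE9 NOT PRINTED ∕ NOT PROVED; «NE9 ⇐ the named binders»; row WALLED ON A MODEL (O-NE9-1; #5 UNRULED);
spine PROVED 0∕9; rung (B)+1 finite T⁴ — NOT infinite volume, NOT mass gap, NOT BetaPertH, NOT Clay).  HONEST DEPENDENCY (cell line): continuum YM on T⁴ ⇐
BetaPertH ∧ nine spine estimates (0/9 proved); BetaPertH ⇐ (D1) ∧ (D4) ∧ CAP+tail; G-an2-4 gates asym, D1 and NE2/3/4.  NEW file; nothing modified.  Net new unproved facts: 0.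
-/

noncomputable section

open scoped InnerProductSpace ComplexConjugate BigOperators

namespace Literature.MathematicalPhysics.QuantumFieldTheory.Balaban1983to89.B9Eq353FormDefectTowerDiagonal

open B4Sect5Torus (TSite)
open B9SectCLatticeCarrier (Bond)
open B11Eq103H1Complex (SiteL2K BondL2K covDerivL2K covDivL2K laplaceALatticeK laplaceAK G1LatticeK adjoint_covDerivL2K projR_projR)
open B9Eq310HessianOperator (adTransportW principalOpK curvOp hessOp hessOp_apply hessOp_one covCurlL2K principalOpK_eq_comp
  covCoCurlL2K_comp_eq_adjoint_comp)
open B9Eq310DeltaPrime (plaqHolU plaqHolU_one)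
open B9Eq315QTorus (perCfg cornerSite)
open B9Eq315QTower (towerP UlevOf)
open B9Eq315QTowerFlat (perCfg_UlevOf_one_mem_U1 norm_Wcx_UlevOf_one_sub_one_le UlevOf_one)
open B9Eq326OperatorTower (laplaceAk QkW RofUk RofUk_isSymmetric)
open B7Prop1Explicit (U1 Wcx boxVec)
open B9Ineq369CurvatureOperatorBound (norm_curvOp_le)
open B9Eq373DerivativeRemainderL2 (norm_covCurlL2K_sub_le norm_covDivL2K_sub_le)
open B9Eq368ProjectionRemainder (norm_projR_le)
open B9Eq384RemainderLetters (norm_adTransportW_sub_le)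
open B9Eq315QTowerLipschitzL2 (norm_QkW_sub_flat_le_L2_geometric)
open B9Eq315QTowerFlatNorm (norm_QkW_one_le_canonical)
open B5Eq172HodgePositivity (adTransportW_one adTransportW_inv_one hRS_one)
open B9Eq3153FrakGkBoundDiagonal (exists_energy_letters_diagonal_closed)
open B9Eq386GreenLipschitzEnergy (norm_inner_sub_inner_le norm_inner_laplaceAK_sub_le)

/-! ## §1 Arithmetic -/

/-- `e^y − 1 ≤ 2y` for `0 ≤ y ≤ 1` (as in `B9Thm311SmallFieldCoercivityTowerDiagonal`). [folklore] -/
private theorem exp_sub_one_le_two_mul {y : ℝ} (hy0 : 0 ≤ y) (hy1 : y ≤ 1) : Real.exp y - 1 ≤ 2 * y := by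
  have h := Real.abs_exp_sub_one_le (x := y) (by rw [abs_of_nonneg hy0]; exact hy1)
  rw [abs_of_nonneg hy0] at h
  exact (le_abs_self _).trans h

/-- On the diagonal `c₀(L^{n+1})^d = c₁` the weighted-reading prefactor is `1`. [cite: Balaban1985BackgroundPropagators, (3.16) p.393] -/
private theorem sqrt_ratio_diagonal {d L n : ℕ} {c₀ c₁ : ℝ} (hc₁ : 0 < c₁) (hw : c₀ * ((L : ℝ) ^ (n + 1)) ^ d = c₁) :
    Real.sqrt (c₁ / (c₀ * ((L : ℝ) ^ (n + 1)) ^ d)) = 1 := by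
  rw [hw, div_self hc₁.ne', Real.sqrt_one]

/-- `x ≤ √S` from `0 ≤ x` and `x² ≤ S`. [folklore] -/
private theorem le_sqrt_of_sq_le {x S : ℝ} (hx : 0 ≤ x) (h : x ^ 2 ≤ S) : x ≤ Real.sqrt S := by
  calc x = Real.sqrt (x ^ 2) := (Real.sqrt_sq hx).symm
    _ ≤ Real.sqrt S := Real.sqrt_le_sqrt h

/-- The defect constant is `α`-linear for `α ≤ 1`: `(s_Dα)(2 + s_Dα) + Kα + (s_Pα)(2 + s_Pα) + a·(C_Qα)(2M_Q + C_Qα) ≤ α·Θ̄`. [folklore] -/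
private theorem theta_le {α sD K sP CQ MQ a : ℝ} (hα0 : 0 ≤ α) (hα1 : α ≤ 1) (ha : 0 ≤ a) :
    (sD * α) * (2 * 1 + sD * α) + K * α + (sP * α) * (2 * 1 + sP * α) + a * ((CQ * α) * (2 * MQ + CQ * α)) ≤
      α * (sD * (2 + sD) + K + sP * (2 + sP) + a * (CQ * (2 * MQ + CQ))) := by
  have h1 : 0 ≤ α * sD ^ 2 * (1 - α) := by have := sub_nonneg.2 hα1; positivity
  have h2 : 0 ≤ α * sP ^ 2 * (1 - α) := by have := sub_nonneg.2 hα1; positivity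
  have h3 : 0 ≤ α * (a * CQ ^ 2) * (1 - α) := by have := sub_nonneg.2 hα1; positivity
  nlinarith [h1, h2, h3]

/-! ## §2 The energy data of the pair on the diagonal -/

variable {d : ℕ} (L : ℕ) [NeZero L] (hL : 1 ≤ L)
  {𝔸 : Type*} [NormedRing 𝔸] [NormedAlgebra ℂ 𝔸] [CompleteSpace 𝔸] [NormOneClass 𝔸] [StarRing 𝔸] [NormedStarGroup 𝔸] [StarModule ℂ 𝔸]
  {W : Type*} [NormedAddCommGroup W] [InnerProductSpace ℂ W] [FiniteDimensional ℂ W] (φ : W ≃ₗ[ℂ] 𝔸)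
  {Mφ Mφ' : ℝ} (hMφ : 0 ≤ Mφ) (hMφ' : 0 ≤ Mφ') (hφ : ∀ w, ‖φ w‖ ≤ Mφ * ‖w‖) (hφ' : ∀ X, ‖φ.symm X‖ ≤ Mφ' * ‖X‖)
  {a : ℝ} (ha : 0 < a) {r : ℝ} (hr0 : 0 ≤ r) (hr1 : r < 1)
  (τ : 𝔸 →ₗ[ℂ] ℂ) {Cτ : ℝ} (hτ : ∀ X, ‖τ X‖ ≤ Cτ * ‖X‖) (hCτ : 0 ≤ Cτ) {ρw : ℝ} (hρw : 0 ≤ ρw) {CR : ℝ} (hCR : 0 ≤ CR)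

include hMφ hMφ' hφ hφ' ha hr0 hr1 hτ hCτ hρw hCR

/-- **THE ENERGY DATA OF THE PAIR `(Δ^{(n+1)}_a(U), Δ^{(n+1)}_a(1))` ON THE DIAGONAL, MODULO `C_R`**: there are `α₀, γ₁, Θ̄ > 0` (closed in
`(d, a, L, M_φ, M_φ′, r, C_τ, ρ_w, C_R)`; `γ₁ = γ(d,a)∕4`) such that for every `n`, `η` (`ηL^{n+1} = 1`), `c₀, c₁` (`c₀(L^{n+1})^d = c₁`, `|η|^d∕c₀ ≤ ρ_w`), `m`,
background `U` of E162's data with `hRS`, the windows `‖U(b) − 1‖ ≤ αη`, `‖U(∂p) − 1‖ ≤ αη²`, `‖Ū^j(b) − 1‖ ≤ ε_j ≤ αr^j`, `0 ≤ α ≤ α₀` and the `R`-letter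
`‖R_k(U)s − R_k(1)s‖ ≤ C_Rα‖s‖`: (i) STRONG coercivity at `U` and (ii) at the flat background in the flat weight, `γ₁(‖curl₁x‖² + ‖div₁x‖² + ‖x‖²) ≤ re⟨x, Δ_a x⟩`
(`B9Eq3153FrakGkBoundDiagonal` §1 twice — the flat background inhabits every window); (iii) THE FORM DEFECT
`‖⟨u, Δ_a(U)v⟩ − ⟨u, Δ_a(1)v⟩‖ ≤ Θ̄·α·N₁(u)N₁(v)`, `N₁(w) = √(‖curl₁w‖² + ‖div₁w‖² + ‖w‖²)`, from FIRST-order letters only (curl∕divergence remainders,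
the curvature operator bound, `C_Rα`, `C_Qα`, `M_Q`; `B9Eq386GreenLipschitzEnergy.norm_inner_laplaceAK_sub_le`).  The data every energy-norm perturbation
argument on the diagonal consumes (this file's Green's function; next: `H_{1,k}`, `𝔊_k`). [cite: Balaban1985BackgroundPropagators, (3.52)–(3.53) p.400, (3.82)–(3.86) p.407, Thm 3.11 p.416, (3.35) p.396] -/
theorem exists_energy_pair_diagonal_closed :
    ∃ α₀ γ₁ Θ : ℝ, 0 < α₀ ∧ 0 < γ₁ ∧ 0 < Θ ∧ ∀ (n : ℕ) (η : ℝ), η * (L : ℝ) ^ (n + 1) = 1 →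
      ∀ (c₀ c₁ : ℝ) [Fact (0 < c₀)] [Fact (0 < c₁)], c₀ * ((L : ℝ) ^ (n + 1)) ^ d = c₁ → |η| ^ d / c₀ ≤ ρw →
      ∀ (m : Fin d → ℕ) [∀ i, NeZero (m i)] (U : Bond d (towerP L m (n + 1)) → 𝔸ˣ) (αU : ℕ → ℝ) (hα1 : ∀ j, αU j ≤ 1 / 64)
        (hU1 : ∀ (j : ℕ) (x : B7Prop1Explicit.Site d) (κ : Fin d), perCfg (towerP L m (j + 1)) (UlevOf L m (n + 1) U j) x κ ∈ U1 𝔸)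
        (hreg : ∀ (j : ℕ) (y : TSite d (towerP L m j)) (κ : Fin d) (r : Fin d → Fin L),
          ‖((Wcx L (perCfg (towerP L m (j + 1)) (UlevOf L m (n + 1) U j)) (cornerSite L y) κ (boxVec L r) : 𝔸ˣ) : 𝔸) - 1‖ ≤ αU j)
        (εU : ℕ → ℝ), (∀ j, 0 ≤ εU j) → (∀ (j : ℕ) (b : Bond d (towerP L m (j + 1))), ‖(UlevOf L m (n + 1) U j b : 𝔸) - 1‖ ≤ εU j) →
      ∀ {α : ℝ}, 0 ≤ α → α ≤ α₀ →
        (∀ (b : Bond d (towerP L m (n + 1))) (v u : W), ⟪adTransportW φ U b v, u⟫_ℂ = ⟪v, adTransportW φ (fun b => (U b)⁻¹) b u⟫_ℂ) →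
        (∀ b, U b ∈ U1 𝔸) → (∀ b, ‖(U b : 𝔸) - 1‖ ≤ α * η) →
        (∀ p : B9SectCLatticeCarrier.Plaq d (towerP L m (n + 1)), ‖(plaqHolU U p : 𝔸) - 1‖ ≤ α * η ^ 2) →
        (∀ j < n + 1, εU j ≤ α * r ^ j) →
        (∀ s : SiteL2K ℂ d (towerP L m (n + 1)) c₀ W,
          ‖RofUk L m n φ η U s - RofUk L m n φ η (fun _ : Bond d (towerP L m (n + 1)) => (1 : 𝔸ˣ)) s‖ ≤ CR * α * ‖s‖) →
        (∀ x : BondL2K ℂ d (towerP L m (n + 1)) c₀ W,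
            γ₁ * (‖covCurlL2K ℂ c₀ ((η : ℂ))⁻¹ (adTransportW φ (fun _ : Bond d (towerP L m (n + 1)) => (1 : 𝔸ˣ))) x‖ ^ 2 + ‖covDivL2K ℂ c₀ ((η : ℂ))⁻¹ (adTransportW φ fun _ : Bond d (towerP L m (n + 1)) => (1 : 𝔸ˣ)⁻¹) x‖ ^ 2 + ‖x‖ ^ 2) ≤ RCLike.re ⟪x, laplaceAk L m n φ η U hL αU hα1 hU1 hreg τ (c₀ := c₀) (c₁ := c₁) a x⟫_ℂ) ∧
        (∀ x : BondL2K ℂ d (towerP L m (n + 1)) c₀ W,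
            γ₁ * (‖covCurlL2K ℂ c₀ ((η : ℂ))⁻¹ (adTransportW φ (fun _ : Bond d (towerP L m (n + 1)) => (1 : 𝔸ˣ))) x‖ ^ 2 + ‖covDivL2K ℂ c₀ ((η : ℂ))⁻¹ (adTransportW φ fun _ : Bond d (towerP L m (n + 1)) => (1 : 𝔸ˣ)⁻¹) x‖ ^ 2 + ‖x‖ ^ 2) ≤ RCLike.re ⟪x, laplaceAk L m n φ η (fun _ : Bond d (towerP L m (n + 1)) => (1 : 𝔸ˣ)) hL (fun _ => 0) (fun _ => by norm_num)
              (perCfg_UlevOf_one_mem_U1 L m (n + 1)) (norm_Wcx_UlevOf_one_sub_one_le L m (n + 1) (fun _ => 0) (fun _ => le_rfl)) τ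
              (c₀ := c₀) (c₁ := c₁) a x⟫_ℂ) ∧
        (∀ u v : BondL2K ℂ d (towerP L m (n + 1)) c₀ W,
            ‖⟪u, laplaceAk L m n φ η U hL αU hα1 hU1 hreg τ (c₀ := c₀) (c₁ := c₁) a v⟫_ℂ - ⟪u, laplaceAk L m n φ η (fun _ : Bond d (towerP L m (n + 1)) => (1 : 𝔸ˣ)) hL (fun _ => 0) (fun _ => by norm_num)
              (perCfg_UlevOf_one_mem_U1 L m (n + 1)) (norm_Wcx_UlevOf_one_sub_one_le L m (n + 1) (fun _ => 0) (fun _ => le_rfl)) τ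
              (c₀ := c₀) (c₁ := c₁) a v⟫_ℂ‖ ≤
              Θ * α * Real.sqrt (‖covCurlL2K ℂ c₀ ((η : ℂ))⁻¹ (adTransportW φ (fun _ : Bond d (towerP L m (n + 1)) => (1 : 𝔸ˣ))) u‖ ^ 2 + ‖covDivL2K ℂ c₀ ((η : ℂ))⁻¹ (adTransportW φ fun _ : Bond d (towerP L m (n + 1)) => (1 : 𝔸ˣ)⁻¹) u‖ ^ 2 + ‖u‖ ^ 2) * Real.sqrt (‖covCurlL2K ℂ c₀ ((η : ℂ))⁻¹ (adTransportW φ (fun _ : Bond d (towerP L m (n + 1)) => (1 : 𝔸ˣ))) v‖ ^ 2 + ‖covDivL2K ℂ c₀ ((η : ℂ))⁻¹ (adTransportW φ fun _ : Bond d (towerP L m (n + 1)) => (1 : 𝔸ˣ)⁻¹) v‖ ^ 2 + ‖v‖ ^ 2)) := by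
  obtain ⟨α₁, γ₁, hα₁, hγ₁, H⟩ := exists_energy_letters_diagonal_closed L hL φ hMφ hMφ' hφ hφ' ha hr0 hr1 τ hτ hCτ hρw
  have hL0 : (0 : ℝ) < L := by exact_mod_cast Nat.pos_of_ne_zero (NeZero.ne L)
  have h1r : 0 < 1 - r := by linarith
  -- the closed letters
  obtain ⟨sD, hsDdef⟩ : ∃ sD : ℝ, sD = 8 * Real.sqrt d * (Mφ * Mφ') := ⟨_, rfl⟩
  obtain ⟨sS, hsSdef⟩ : ∃ sS : ℝ, sS = 2 * Real.sqrt d * (Mφ * Mφ') := ⟨_, rfl⟩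
  obtain ⟨Kc, hKcdef⟩ : ∃ Kc : ℝ, Kc = 32 * d * Cτ * Mφ ^ 2 * ρw := ⟨_, rfl⟩
  obtain ⟨Ξ, hΞdef⟩ : ∃ Ξ : ℝ, Ξ = Real.sqrt ((L : ℝ) ^ d) * (Real.sqrt (2 * d) * (102 * (d + 1) ^ 2 * L)) := ⟨_, rfl⟩
  obtain ⟨CQ, hCQdef⟩ : ∃ CQ : ℝ, CQ = 2 * (Mφ' * Mφ) * Ξ / (1 - r) := ⟨_, rfl⟩
  obtain ⟨sP, hsPdef⟩ : ∃ sP : ℝ, sP = sS + CR := ⟨_, rfl⟩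
  obtain ⟨Θb, hΘbdef⟩ : ∃ Θb : ℝ, Θb = sD * (2 + sD) + Kc + sP * (2 + sP) + a * (CQ * (2 * (Mφ' * Mφ) + CQ)) := ⟨_, rfl⟩
  have hsD : 0 ≤ sD := by rw [hsDdef]; positivity
  have hsS : 0 ≤ sS := by rw [hsSdef]; positivity
  have hKc : 0 ≤ Kc := by rw [hKcdef]; positivity
  have hΞ0 : 0 ≤ Ξ := by rw [hΞdef]; positivity
  have hCQ : 0 ≤ CQ := by rw [hCQdef]; positivity
  have hsP : 0 ≤ sP := by rw [hsPdef]; positivity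
  have hΘb : 0 ≤ Θb := by rw [hΘbdef]; positivity
  have hMM : 0 ≤ Mφ' * Mφ := mul_nonneg hMφ' hMφ
  refine ⟨min α₁ (min 1 ((1 - r) / (Ξ + 1))), γ₁, Θb + 1, lt_min hα₁ (lt_min one_pos (by positivity)), hγ₁, by positivity, ?_⟩
  intro n η hηL c₀ c₁ _ _ hw hρ m _ U αU hα1 hU1 hreg εU hεU hUε α hα0 hαle hRS hUb hUη hpl hεg hR
  -- scalar facts FIRST (thin context)
  have hc₁ : 0 < c₁ := Fact.out
  have hLr : (0 : ℝ) < (L : ℝ) ^ (n + 1) := pow_pos hL0 _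
  have hηL0 : 0 < η * (L : ℝ) ^ (n + 1) := by rw [hηL]; exact one_pos
  have hη0 : 0 < η := pos_of_mul_pos_left hηL0 hLr.le
  have hc : conj ((η : ℂ))⁻¹ = ((η : ℂ))⁻¹ := by rw [map_inv₀, Complex.conj_ofReal]
  have hnη : ‖((η : ℂ))⁻¹‖ * η = 1 := by
    rw [norm_inv, Complex.norm_real, Real.norm_eq_abs, abs_of_pos hη0, inv_mul_cancel₀ hη0.ne']
  have hnη2 : ‖((η : ℂ))⁻¹‖ ^ 2 * (α * η ^ 2) = α := by
    rw [show ‖((η : ℂ))⁻¹‖ ^ 2 * (α * η ^ 2) = (‖((η : ℂ))⁻¹‖ * η) ^ 2 * α by ring, hnη, one_pow, one_mul]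
  have hs : c₁ * (η * (L : ℝ) ^ (n + 1)) ^ 2 = c₀ * ((L : ℝ) ^ (n + 1)) ^ d := by rw [hηL, one_pow, mul_one, hw]
  have hαα₁ : α ≤ α₁ := hαle.trans (min_le_left _ _)
  have hαone : α ≤ 1 := hαle.trans ((min_le_right _ _).trans (min_le_left _ _))
  have hαΞ : Ξ * (α / (1 - r)) ≤ 1 := by
    have h1 : α ≤ (1 - r) / (Ξ + 1) := hαle.trans ((min_le_right _ _).trans (min_le_right _ _))
    rw [← mul_div_assoc, div_le_one h1r]
    calc Ξ * α ≤ Ξ * ((1 - r) / (Ξ + 1)) := mul_le_mul_of_nonneg_left h1 hΞ0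
      _ ≤ 1 - r := by
          rw [mul_div_assoc', div_le_iff₀ (add_pos_of_nonneg_of_pos hΞ0 one_pos)]
          calc Ξ * (1 - r) ≤ Ξ * (1 - r) + (1 - r) := le_add_of_nonneg_right h1r.le
            _ = (1 - r) * (Ξ + 1) := by ring
  have hαη : 0 ≤ α * η := mul_nonneg hα0 hη0.le
  have hεR0 : 0 ≤ 2 * Mφ * Mφ' * (α * η) := mul_nonneg (mul_nonneg (mul_nonneg zero_le_two hMφ) hMφ') hαη
  have hαη2 : 0 ≤ α * η ^ 2 := mul_nonneg hα0 (sq_nonneg η)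
  have hαr : ∀ j : ℕ, 0 ≤ α * r ^ j := fun j => mul_nonneg hα0 (pow_nonneg hr0 j)
  have hsDα : 0 ≤ sD * α := mul_nonneg hsD hα0
  have hsSα : 0 ≤ sS * α := mul_nonneg hsS hα0
  have hKcα : 0 ≤ Kc * α := mul_nonneg hKc hα0
  have hsPα : 0 ≤ sP * α := mul_nonneg hsP hα0
  have hCQα : 0 ≤ CQ * α := mul_nonneg hCQ hα0
  have hCRα : 0 ≤ CR * α := mul_nonneg hCR hα0
  have he : Real.exp (Ξ * (α / (1 - r))) - 1 ≤ 2 * (Ξ * (α / (1 - r))) :=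
    exp_sub_one_le_two_mul (mul_nonneg hΞ0 (div_nonneg hα0 h1r.le)) hαΞ
  have heM : Mφ' * Mφ * (Real.exp (Ξ * (α / (1 - r))) - 1) ≤ CQ * α := by
    have h1 := mul_le_mul_of_nonneg_left he hMM
    have h2 : Mφ' * Mφ * (2 * (Ξ * (α / (1 - r)))) = CQ * α := by rw [hCQdef]; ring
    rw [← h2]; exact h1
  have hsDe : 4 * Real.sqrt d * (‖((η : ℂ))⁻¹‖ * (2 * Mφ * Mφ' * (α * η))) = sD * α := by
    rw [hsDdef, show ‖((η : ℂ))⁻¹‖ * (2 * Mφ * Mφ' * (α * η)) = 2 * Mφ * Mφ' * α * (‖((η : ℂ))⁻¹‖ * η) by ring, hnη]; ring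
  have hsSe : ‖((η : ℂ))⁻¹‖ * (2 * Mφ * Mφ' * (α * η)) * Real.sqrt d = sS * α := by
    rw [hsSdef, show ‖((η : ℂ))⁻¹‖ * (2 * Mφ * Mφ' * (α * η)) = 2 * Mφ * Mφ' * α * (‖((η : ℂ))⁻¹‖ * η) by ring, hnη]; ring
  have hK2 : 32 * d * Cτ * Mφ ^ 2 * (|η| ^ d / c₀) * α ≤ Kc * α := by
    rw [hKcdef]
    exact mul_le_mul_of_nonneg_right (mul_le_mul_of_nonneg_left hρ
      (mul_nonneg (mul_nonneg (mul_nonneg (by norm_num) (Nat.cast_nonneg d)) hCτ) (sq_nonneg Mφ))) hα0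
  obtain ⟨Θα, hΘαdef⟩ : ∃ Θα : ℝ, Θα = ((sD * α) * (2 * 1 + sD * α) + Kc * α) + (sP * α) * (2 * 1 + sP * α) +
      ‖((a : ℝ) : ℂ)‖ * ((CQ * α) * (2 * (Mφ' * Mφ) + CQ * α)) := ⟨_, rfl⟩
  have hna : ‖((a : ℝ) : ℂ)‖ = a := by rw [Complex.norm_real, Real.norm_eq_abs, abs_of_pos ha]
  have hΘα0 : 0 ≤ Θα := by
    rw [hΘαdef, hna]
    have t1 : 0 ≤ (sD * α) * (2 * 1 + sD * α) := mul_nonneg hsDα (by linarith only [hsDα])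
    have t2 : 0 ≤ (sP * α) * (2 * 1 + sP * α) := mul_nonneg hsPα (by linarith only [hsPα])
    have t3 : 0 ≤ a * ((CQ * α) * (2 * (Mφ' * Mφ) + CQ * α)) := mul_nonneg ha.le (mul_nonneg hCQα (by linarith only [hMM, hCQα]))
    linarith only [t1, t2, t3, hKcα]
  have hΘle : Θα ≤ α * Θb := by
    rw [hΘαdef, hΘbdef, hna]
    exact theta_le hα0 hαone ha.le
  -- §1 of `B9Eq3153FrakGkBoundDiagonal` at `U` and at the flat background
  have HU := H n η hηL c₀ c₁ hw hρ m U αU hα1 hU1 hreg εU hεU hUε hα0 hαα₁ hRS hUb hUη hpl hεg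
  have hUε1 : ∀ (j : ℕ) (b : Bond d (towerP L m (j + 1))),
      ‖(UlevOf L m (n + 1) (fun _ : Bond d (towerP L m (n + 1)) => (1 : 𝔸ˣ)) j b : 𝔸) - 1‖ ≤ (fun _ : ℕ => (0 : ℝ)) j := by
    intro j b; rw [UlevOf_one, Units.val_one, sub_self, norm_zero]
  have H1 := H n η hηL c₀ c₁ hw hρ m (fun _ : Bond d (towerP L m (n + 1)) => (1 : 𝔸ˣ)) (fun _ => 0) (fun _ => by norm_num)
    (perCfg_UlevOf_one_mem_U1 L m (n + 1)) (norm_Wcx_UlevOf_one_sub_one_le L m (n + 1) (fun _ => 0) (fun _ => le_rfl)) (fun _ => 0)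
    (fun _ => le_rfl) hUε1 hα0 hαα₁ (hRS_one φ) (fun _ => Subgroup.one_mem _)
    (fun _ => by rw [Units.val_one, sub_self, norm_zero]; exact hαη)
    (fun p => by rw [plaqHolU_one, Units.val_one, sub_self, norm_zero]; exact hαη2) (fun j _ => hαr j)
  -- the flat energy weight `N₁` (an opaque name with its defining equation)
  obtain ⟨N, hNdef⟩ : ∃ N : BondL2K ℂ d (towerP L m (n + 1)) c₀ W → ℝ, N = fun z =>
      Real.sqrt (‖covCurlL2K ℂ c₀ ((η : ℂ))⁻¹ (adTransportW φ (fun _ : Bond d (towerP L m (n + 1)) => (1 : 𝔸ˣ))) z‖ ^ 2 + ‖covDivL2K ℂ c₀ ((η : ℂ))⁻¹ (adTransportW φ fun _ : Bond d (towerP L m (n + 1)) => (1 : 𝔸ˣ)⁻¹) z‖ ^ 2 + ‖z‖ ^ 2) := ⟨_, rfl⟩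
  have hNz : ∀ z, N z = Real.sqrt (‖covCurlL2K ℂ c₀ ((η : ℂ))⁻¹ (adTransportW φ (fun _ : Bond d (towerP L m (n + 1)) => (1 : 𝔸ˣ))) z‖ ^ 2 + ‖covDivL2K ℂ c₀ ((η : ℂ))⁻¹ (adTransportW φ fun _ : Bond d (towerP L m (n + 1)) => (1 : 𝔸ˣ)⁻¹) z‖ ^ 2 + ‖z‖ ^ 2) := fun z => by rw [hNdef]
  have hN0 : ∀ z, 0 ≤ N z := fun z => by rw [hNz]; exact Real.sqrt_nonneg _
  have hNsq : ∀ z, N z ^ 2 = ‖covCurlL2K ℂ c₀ ((η : ℂ))⁻¹ (adTransportW φ (fun _ : Bond d (towerP L m (n + 1)) => (1 : 𝔸ˣ))) z‖ ^ 2 + ‖covDivL2K ℂ c₀ ((η : ℂ))⁻¹ (adTransportW φ fun _ : Bond d (towerP L m (n + 1)) => (1 : 𝔸ˣ)⁻¹) z‖ ^ 2 + ‖z‖ ^ 2 := fun z => by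
    rw [hNz]; exact Real.sq_sqrt (add_nonneg (add_nonneg (sq_nonneg _) (sq_nonneg _)) (sq_nonneg _))
  have hNn : ∀ z, ‖z‖ ≤ N z := fun z => by
    rw [hNz]; exact le_sqrt_of_sq_le (norm_nonneg _) (le_add_of_nonneg_left (add_nonneg (sq_nonneg _) (sq_nonneg _)))
  have hNc : ∀ z, ‖covCurlL2K ℂ c₀ ((η : ℂ))⁻¹ (adTransportW φ (fun _ : Bond d (towerP L m (n + 1)) => (1 : 𝔸ˣ))) z‖ ≤ N z := fun z => by
    rw [hNz]; exact le_sqrt_of_sq_le (norm_nonneg _) ((le_add_of_nonneg_right (sq_nonneg _)).trans (le_add_of_nonneg_right (sq_nonneg _)))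
  have hNd : ∀ z, ‖covDivL2K ℂ c₀ ((η : ℂ))⁻¹ (adTransportW φ fun _ : Bond d (towerP L m (n + 1)) => (1 : 𝔸ˣ)⁻¹) z‖ ≤ N z := fun z => by
    rw [hNz]; exact le_sqrt_of_sq_le (norm_nonneg _) ((le_add_of_nonneg_left (sq_nonneg _)).trans (le_add_of_nonneg_right (sq_nonneg _)))
  -- the first-order letters
  have hRε : ∀ (b : Bond d (towerP L m (n + 1))) (w : W), ‖adTransportW φ U b w - w‖ ≤ (2 * Mφ * Mφ' * (α * η)) * ‖w‖ :=
    fun b w => norm_adTransportW_sub_le φ hφ hφ' hMφ' U b (hUb b) (hUη b) w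
  have hR₁ : ∀ (b : Bond d (towerP L m (n + 1))) (w : W), adTransportW φ (fun _ : Bond d (towerP L m (n + 1)) => (1 : 𝔸ˣ)) b w = w :=
    fun b w => by rw [adTransportW_one]; rfl
  have hS₁ : ∀ (b : Bond d (towerP L m (n + 1))) (w : W), adTransportW φ (fun _ : Bond d (towerP L m (n + 1)) => (1 : 𝔸ˣ)⁻¹) b w = w :=
    fun b w => by rw [adTransportW_inv_one]; rfl
  -- δ_D, δ_S: the curl and divergence remainders
  have hD : ∀ w : BondL2K ℂ d (towerP L m (n + 1)) c₀ W, ‖covCurlL2K ℂ c₀ ((η : ℂ))⁻¹ (adTransportW φ U) w - covCurlL2K ℂ c₀ ((η : ℂ))⁻¹ (adTransportW φ (fun _ : Bond d (towerP L m (n + 1)) => (1 : 𝔸ˣ))) w‖ ≤ (sD * α) * N w := fun w => by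
    have h := norm_covCurlL2K_sub_le ((η : ℂ))⁻¹ hεR0 hRε hR₁ w
    rw [hsDe] at h
    exact h.trans (mul_le_mul_of_nonneg_left (hNn w) hsDα)
  have hSv : ∀ w : BondL2K ℂ d (towerP L m (n + 1)) c₀ W, ‖covDivL2K ℂ c₀ ((η : ℂ))⁻¹ (adTransportW φ fun b => (U b)⁻¹) w - covDivL2K ℂ c₀ ((η : ℂ))⁻¹ (adTransportW φ fun _ : Bond d (towerP L m (n + 1)) => (1 : 𝔸ˣ)⁻¹) w‖ ≤ (sS * α) * ‖w‖ := fun w => by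
    have h := norm_covDivL2K_sub_le ((η : ℂ))⁻¹ hc hεR0 hRε hR₁ hRS hS₁ w
    rw [hsSe] at h; exact h
  -- the principal parts as products of curls
  have hprU : ∀ u v : BondL2K ℂ d (towerP L m (n + 1)) c₀ W, ⟪u, principalOpK φ η U v⟫_ℂ = ⟪covCurlL2K ℂ c₀ ((η : ℂ))⁻¹ (adTransportW φ U) u, covCurlL2K ℂ c₀ ((η : ℂ))⁻¹ (adTransportW φ U) v⟫_ℂ := fun u v => by
    rw [principalOpK_eq_comp, covCoCurlL2K_comp_eq_adjoint_comp _ hc _ _ hRS, LinearMap.comp_apply, LinearMap.adjoint_inner_right]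
  have hpr1 : ∀ u v : BondL2K ℂ d (towerP L m (n + 1)) c₀ W, ⟪u, principalOpK φ η (fun _ : Bond d (towerP L m (n + 1)) => (1 : 𝔸ˣ)) v⟫_ℂ = ⟪covCurlL2K ℂ c₀ ((η : ℂ))⁻¹ (adTransportW φ (fun _ : Bond d (towerP L m (n + 1)) => (1 : 𝔸ˣ))) u, covCurlL2K ℂ c₀ ((η : ℂ))⁻¹ (adTransportW φ (fun _ : Bond d (towerP L m (n + 1)) => (1 : 𝔸ˣ))) v⟫_ℂ := fun u v => by
    rw [principalOpK_eq_comp, covCoCurlL2K_comp_eq_adjoint_comp _ hc _ _ (hRS_one φ), LinearMap.comp_apply, LinearMap.adjoint_inner_right]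
  -- θ_Δ: the Hessian's form defect (curl bracket + curvature operator bound)
  have hUb' : ∀ b : Bond d (towerP L m (n + 1)), ‖(U b : 𝔸)‖ ≤ 1 ∧ ‖(((U b)⁻¹ : 𝔸ˣ) : 𝔸)‖ ≤ 1 := fun b => B7Prop1Explicit.mem_U1.1 (hUb b)
  have hKop : ∀ v : BondL2K ℂ d (towerP L m (n + 1)) c₀ W, ‖curvOp φ τ η U v‖ ≤ Kc * α * ‖v‖ := fun v => by
    have h := norm_curvOp_le φ hτ hCτ hφ η hUb' hpl hMφ hαη2 v
    rw [hnη2] at h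
    exact h.trans (mul_le_mul_of_nonneg_right hK2 (norm_nonneg _))
  have hΔ : ∀ u v : BondL2K ℂ d (towerP L m (n + 1)) c₀ W, ‖⟪u, hessOp φ η U τ v⟫_ℂ - ⟪u, hessOp φ η (fun _ : Bond d (towerP L m (n + 1)) => (1 : 𝔸ˣ)) τ v⟫_ℂ‖ ≤ ((sD * α) * (2 * 1 + sD * α) + Kc * α) * N u * N v := by
    intro u v
    rw [hessOp_apply, hessOp_one, inner_add_right, hprU, hpr1, add_sub_right_comm]
    have hbr := norm_inner_sub_inner_le (𝕜 := ℂ) (fun w => covCurlL2K ℂ c₀ ((η : ℂ))⁻¹ (adTransportW φ U) w) (fun w => covCurlL2K ℂ c₀ ((η : ℂ))⁻¹ (adTransportW φ (fun _ : Bond d (towerP L m (n + 1)) => (1 : 𝔸ˣ))) w) N hN0 hsDα zero_le_one hD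
      (fun w => by rw [one_mul]; exact hNc w) u v
    have hcv : ‖⟪u, curvOp φ τ η U v⟫_ℂ‖ ≤ Kc * α * N u * N v :=
      calc ‖⟪u, curvOp φ τ η U v⟫_ℂ‖ ≤ ‖u‖ * ‖curvOp φ τ η U v‖ := norm_inner_le_norm _ _
        _ ≤ N u * (Kc * α * N v) := mul_le_mul (hNn u) ((hKop v).trans (mul_le_mul_of_nonneg_left (hNn v) hKcα)) (norm_nonneg _) (hN0 u)
        _ = Kc * α * N u * N v := by ring
    calc ‖⟪covCurlL2K ℂ c₀ ((η : ℂ))⁻¹ (adTransportW φ U) u, covCurlL2K ℂ c₀ ((η : ℂ))⁻¹ (adTransportW φ U) v⟫_ℂ - ⟪covCurlL2K ℂ c₀ ((η : ℂ))⁻¹ (adTransportW φ (fun _ : Bond d (towerP L m (n + 1)) => (1 : 𝔸ˣ))) u, covCurlL2K ℂ c₀ ((η : ℂ))⁻¹ (adTransportW φ (fun _ : Bond d (towerP L m (n + 1)) => (1 : 𝔸ˣ))) v⟫_ℂ + ⟪u, curvOp φ τ η U v⟫_ℂ‖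
        ≤ ‖⟪covCurlL2K ℂ c₀ ((η : ℂ))⁻¹ (adTransportW φ U) u, covCurlL2K ℂ c₀ ((η : ℂ))⁻¹ (adTransportW φ U) v⟫_ℂ - ⟪covCurlL2K ℂ c₀ ((η : ℂ))⁻¹ (adTransportW φ (fun _ : Bond d (towerP L m (n + 1)) => (1 : 𝔸ˣ))) u, covCurlL2K ℂ c₀ ((η : ℂ))⁻¹ (adTransportW φ (fun _ : Bond d (towerP L m (n + 1)) => (1 : 𝔸ˣ))) v⟫_ℂ‖ + ‖⟪u, curvOp φ τ η U v⟫_ℂ‖ := norm_add_le _ _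
      _ ≤ (sD * α) * (2 * 1 + sD * α) * N u * N v + Kc * α * N u * N v := add_le_add hbr hcv
      _ = ((sD * α) * (2 * 1 + sD * α) + Kc * α) * N u * N v := by ring
  -- `R_k` is a contraction (explicit unfolding keeps the unifier first-order)
  have hRle : ∀ v : SiteL2K ℂ d (towerP L m (n + 1)) c₀ W, ‖RofUk L m n φ η U v‖ ≤ ‖v‖ := fun v => by
    unfold RofUk B11Eq103H1Complex.RLatticeK; exact norm_projR_le _ _ v
  have hR1le : ∀ v : SiteL2K ℂ d (towerP L m (n + 1)) c₀ W, ‖RofUk L m n φ η (fun _ : Bond d (towerP L m (n + 1)) => (1 : 𝔸ˣ)) v‖ ≤ ‖v‖ := fun v => by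
    unfold RofUk B11Eq103H1Complex.RLatticeK; exact norm_projR_le _ _ v
  -- δ_P, M_P: the `RD*`-letters
  have hP : ∀ w : BondL2K ℂ d (towerP L m (n + 1)) c₀ W, ‖RofUk L m n φ η U (covDivL2K ℂ c₀ ((η : ℂ))⁻¹ (adTransportW φ fun b => (U b)⁻¹) w) - RofUk L m n φ η (fun _ : Bond d (towerP L m (n + 1)) => (1 : 𝔸ˣ)) (covDivL2K ℂ c₀ ((η : ℂ))⁻¹ (adTransportW φ fun _ : Bond d (towerP L m (n + 1)) => (1 : 𝔸ˣ)⁻¹) w)‖ ≤ (sP * α) * N w := by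
    intro w
    have h1 : ‖RofUk L m n φ η U (covDivL2K ℂ c₀ ((η : ℂ))⁻¹ (adTransportW φ fun b => (U b)⁻¹) w) - RofUk L m n φ η U (covDivL2K ℂ c₀ ((η : ℂ))⁻¹ (adTransportW φ fun _ : Bond d (towerP L m (n + 1)) => (1 : 𝔸ˣ)⁻¹) w)‖ ≤ (sS * α) * ‖w‖ := by
      rw [← map_sub]; exact (hRle _).trans (hSv w)
    have h2 := hR (covDivL2K ℂ c₀ ((η : ℂ))⁻¹ (adTransportW φ fun _ : Bond d (towerP L m (n + 1)) => (1 : 𝔸ˣ)⁻¹) w)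
    have h3 := norm_sub_le_norm_sub_add_norm_sub (RofUk L m n φ η U (covDivL2K ℂ c₀ ((η : ℂ))⁻¹ (adTransportW φ fun b => (U b)⁻¹) w)) (RofUk L m n φ η U (covDivL2K ℂ c₀ ((η : ℂ))⁻¹ (adTransportW φ fun _ : Bond d (towerP L m (n + 1)) => (1 : 𝔸ˣ)⁻¹) w))
      (RofUk L m n φ η (fun _ : Bond d (towerP L m (n + 1)) => (1 : 𝔸ˣ)) (covDivL2K ℂ c₀ ((η : ℂ))⁻¹ (adTransportW φ fun _ : Bond d (towerP L m (n + 1)) => (1 : 𝔸ˣ)⁻¹) w))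
    have h4 : (sS * α) * ‖w‖ ≤ (sS * α) * N w := mul_le_mul_of_nonneg_left (hNn w) hsSα
    have h5 : CR * α * ‖covDivL2K ℂ c₀ ((η : ℂ))⁻¹ (adTransportW φ fun _ : Bond d (towerP L m (n + 1)) => (1 : 𝔸ˣ)⁻¹) w‖ ≤ CR * α * N w := mul_le_mul_of_nonneg_left (hNd w) hCRα
    have h6 : (sS * α) * N w + CR * α * N w = (sP * α) * N w := by rw [hsPdef]; ring
    exact h3.trans ((add_le_add (h1.trans h4) (h2.trans h5)).trans h6.le)
  have hP₀ : ∀ w : BondL2K ℂ d (towerP L m (n + 1)) c₀ W, ‖RofUk L m n φ η (fun _ : Bond d (towerP L m (n + 1)) => (1 : 𝔸ˣ)) (covDivL2K ℂ c₀ ((η : ℂ))⁻¹ (adTransportW φ fun _ : Bond d (towerP L m (n + 1)) => (1 : 𝔸ˣ)⁻¹) w)‖ ≤ 1 * N w :=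
    fun w => (hR1le _).trans (by rw [one_mul]; exact hNd w)
  -- δ_Q, M_Q: the averaging letters (as `B9Thm311SmallFieldCoercivityTowerDiagonal`)
  have hQ₁ : ∀ w : BondL2K ℂ d (towerP L m (n + 1)) c₀ W, ‖QkW L m n φ (fun _ : Bond d (towerP L m (n + 1)) => (1 : 𝔸ˣ)) hL (fun _ => 0) (fun _ => by norm_num)
        (perCfg_UlevOf_one_mem_U1 L m (n + 1)) (norm_Wcx_UlevOf_one_sub_one_le L m (n + 1) (fun _ => 0) (fun _ => le_rfl)) (c₀ := c₀) (c₁ := c₁) w‖ ≤ Mφ' * Mφ * N w := fun w => by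
    have h := norm_QkW_one_le_canonical L m n hL φ hMφ hφ hMφ' hφ' (fun _ => 0) (fun _ => by norm_num)
      (perCfg_UlevOf_one_mem_U1 L m (n + 1)) (norm_Wcx_UlevOf_one_sub_one_le L m (n + 1) (fun _ => 0) (fun _ => le_rfl)) (c₀ := c₀)
      (c₁ := c₁) hηL0 hs w
    rw [hηL, inv_one, mul_one] at h
    exact h.trans (mul_le_mul_of_nonneg_left (hNn w) hMM)
  have hQd : ∀ w : BondL2K ℂ d (towerP L m (n + 1)) c₀ W, ‖QkW L m n φ U hL αU hα1 hU1 hreg (c₀ := c₀) (c₁ := c₁) w - QkW L m n φ (fun _ : Bond d (towerP L m (n + 1)) => (1 : 𝔸ˣ)) hL (fun _ => 0) (fun _ => by norm_num)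
        (perCfg_UlevOf_one_mem_U1 L m (n + 1)) (norm_Wcx_UlevOf_one_sub_one_le L m (n + 1) (fun _ => 0) (fun _ => le_rfl)) (c₀ := c₀) (c₁ := c₁) w‖ ≤ (CQ * α) * N w := fun w => by
    have h := norm_QkW_sub_flat_le_L2_geometric L m n hL φ hMφ hMφ' hφ hφ' (c₀ := c₀) (c₁ := c₁) U αU hα1 hU1 hreg εU hεU hUε hr0 hr1 hα0
      hεg w
    rw [sqrt_ratio_diagonal hc₁ hw, mul_one, ← hΞdef] at h
    exact h.trans ((mul_le_mul_of_nonneg_right heM (norm_nonneg _)).trans (mul_le_mul_of_nonneg_left (hNn w) hCQα))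
  -- the structure letters
  have hadjU : ∀ (x : BondL2K ℂ d (towerP L m (n + 1)) c₀ W) (z : BondL2K ℂ d m c₁ W),
      ⟪QkW L m n φ U hL αU hα1 hU1 hreg (c₁ := c₁) x, z⟫_ℂ = ⟪x, LinearMap.adjoint (QkW L m n φ U hL αU hα1 hU1 hreg (c₁ := c₁)) z⟫_ℂ :=
    fun x z => (LinearMap.adjoint_inner_right _ x z).symm
  have hadj1 : ∀ (x : BondL2K ℂ d (towerP L m (n + 1)) c₀ W) (z : BondL2K ℂ d m c₁ W), ⟪QkW L m n φ (fun _ : Bond d (towerP L m (n + 1)) => (1 : 𝔸ˣ)) hL (fun _ => 0) (fun _ => by norm_num)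
        (perCfg_UlevOf_one_mem_U1 L m (n + 1)) (norm_Wcx_UlevOf_one_sub_one_le L m (n + 1) (fun _ => 0) (fun _ => le_rfl)) (c₀ := c₀) (c₁ := c₁) x, z⟫_ℂ = ⟪x, LinearMap.adjoint (QkW L m n φ (fun _ : Bond d (towerP L m (n + 1)) => (1 : 𝔸ˣ)) hL (fun _ => 0) (fun _ => by norm_num)
        (perCfg_UlevOf_one_mem_U1 L m (n + 1)) (norm_Wcx_UlevOf_one_sub_one_le L m (n + 1) (fun _ => 0) (fun _ => le_rfl)) (c₀ := c₀) (c₁ := c₁)) z⟫_ℂ :=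
    fun x z => (LinearMap.adjoint_inner_right _ x z).symm
  have hDDU : ∀ (s : SiteL2K ℂ d (towerP L m (n + 1)) c₀ W) (x : BondL2K ℂ d (towerP L m (n + 1)) c₀ W),
      ⟪covDerivL2K ℂ c₀ ((η : ℂ))⁻¹ (adTransportW φ U) s, x⟫_ℂ = ⟪s, covDivL2K ℂ c₀ ((η : ℂ))⁻¹ (adTransportW φ fun b => (U b)⁻¹) x⟫_ℂ := by
    intro s x; rw [← adjoint_covDerivL2K ((η : ℂ))⁻¹ hc _ _ hRS, LinearMap.adjoint_inner_right]
  have hDD1 : ∀ (s : SiteL2K ℂ d (towerP L m (n + 1)) c₀ W) (x : BondL2K ℂ d (towerP L m (n + 1)) c₀ W),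
      ⟪covDerivL2K ℂ c₀ ((η : ℂ))⁻¹ (adTransportW φ (fun _ : Bond d (towerP L m (n + 1)) => (1 : 𝔸ˣ))) s, x⟫_ℂ = ⟪s, covDivL2K ℂ c₀ ((η : ℂ))⁻¹ (adTransportW φ fun _ : Bond d (towerP L m (n + 1)) => (1 : 𝔸ˣ)⁻¹) x⟫_ℂ := by
    intro s x; rw [← adjoint_covDerivL2K ((η : ℂ))⁻¹ hc _ _ (hRS_one φ), LinearMap.adjoint_inner_right]
  have hRsymU : ∀ s t : SiteL2K ℂ d (towerP L m (n + 1)) c₀ W, ⟪RofUk L m n φ η U s, t⟫_ℂ = ⟪s, RofUk L m n φ η U t⟫_ℂ :=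
    fun s t => RofUk_isSymmetric L m n φ η U s t
  have hRsym1 : ∀ s t : SiteL2K ℂ d (towerP L m (n + 1)) c₀ W, ⟪RofUk L m n φ η (fun _ : Bond d (towerP L m (n + 1)) => (1 : 𝔸ˣ)) s, t⟫_ℂ = ⟪s, RofUk L m n φ η (fun _ : Bond d (towerP L m (n + 1)) => (1 : 𝔸ˣ)) t⟫_ℂ :=
    fun s t => RofUk_isSymmetric L m n φ η _ s t
  have hRRU : ∀ s : SiteL2K ℂ d (towerP L m (n + 1)) c₀ W, RofUk L m n φ η U (RofUk L m n φ η U s) = RofUk L m n φ η U s :=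
    fun s => by unfold RofUk B11Eq103H1Complex.RLatticeK; exact projR_projR _ _ s
  have hRR1 : ∀ s : SiteL2K ℂ d (towerP L m (n + 1)) c₀ W, RofUk L m n φ η (fun _ : Bond d (towerP L m (n + 1)) => (1 : 𝔸ˣ)) (RofUk L m n φ η (fun _ : Bond d (towerP L m (n + 1)) => (1 : 𝔸ˣ)) s) = RofUk L m n φ η (fun _ : Bond d (towerP L m (n + 1)) => (1 : 𝔸ˣ)) s :=
    fun s => by unfold RofUk B11Eq103H1Complex.RLatticeK; exact projR_projR _ _ s
  -- the form defect
  have hT : ∀ u v : BondL2K ℂ d (towerP L m (n + 1)) c₀ W, ‖⟪u, laplaceAk L m n φ η U hL αU hα1 hU1 hreg τ (c₀ := c₀) (c₁ := c₁) a v⟫_ℂ - ⟪u, laplaceAk L m n φ η (fun _ : Bond d (towerP L m (n + 1)) => (1 : 𝔸ˣ)) hL (fun _ => 0) (fun _ => by norm_num)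
      (perCfg_UlevOf_one_mem_U1 L m (n + 1)) (norm_Wcx_UlevOf_one_sub_one_le L m (n + 1) (fun _ => 0) (fun _ => le_rfl)) τ (c₀ := c₀) (c₁ := c₁) a v⟫_ℂ‖ ≤ Θα * N u * N v := by
    intro u v
    have h := norm_inner_laplaceAK_sub_le (𝕜 := ℂ) (a := ((a : ℝ) : ℂ)) hadj1 hDD1 hRsym1 hRR1 hadjU hDDU hRsymU hRRU N hN0 hsPα zero_le_one hCQα hMM
      hΔ hP hP₀ hQd hQ₁ u v
    rw [hΘαdef]
    rw [laplaceAk, laplaceAk, laplaceALatticeK, laplaceALatticeK]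
    exact h
  -- assemble
  refine ⟨fun x => (HU x).1, fun x => (H1 x).1, fun u v => ?_⟩
  have hNuv : 0 ≤ N u * N v := mul_nonneg (hN0 u) (hN0 v)
  have h1 : Θα * N u * N v ≤ (Θb + 1) * α * N u * N v := by
    have h2 : Θα ≤ (Θb + 1) * α := hΘle.trans (by rw [add_mul, one_mul, mul_comm]; exact le_add_of_nonneg_right hα0)
    have h3 := mul_le_mul_of_nonneg_right h2 hNuv
    simpa only [mul_assoc] using h3
  rw [← hNz u, ← hNz v] at *
  exact (hT u v).trans h1

end Literature.MathematicalPhysics.QuantumFieldTheory.Balaban1983to89.B9Eq353FormDefectTowerDiagonal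

end
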